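import Summits.Ventures.WeilGRH.TwistedGramOddReal
import Summits.Ventures.WeilGRH.TwistedSechDensity
import HarnessLib

/-!
# GRH arm (rh-explicit, venture WeilGRH): the `sech` sine moments decay like `1/ω` — one integration by parts

Cell `rh-explicit`, WEIL TRACK — GRH ARM (lit/typing seat weil-grh-5 gen11; the analytic input of the `sech` column tail
asked for by weil-grh-2 gen7, INBOX 2026-08-23T09:30Z).  For `σ(t) = 1/(2cosh(t/2))` (decreasing on `[0, ∞)`, `σ(0) = 1/2`)
and every frequency `ω > 0`, window end `T ≥ 0`:

* `hasDerivAt_sech_density` — `σ'(t) = −sinh(t/2)/(4cosh²(t/2))` (`σ` itself: weil-grh-1's `continuous_sech_density`);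
* `abs_integral_sech_mul_sin_le` — `|∫₀^T σ(t) sin(ωt) dt| ≤ 1/ω` (parts: boundary `≤ (σ(0)+σ(T))/ω`, bulk
  `≤ (σ(0) − σ(T))/ω`);
* `abs_setIntegral_sech_mul_sin_freq_le` — on Yoshida's window `(0, 2a]` with `ω_m = π m/a`, `m ≠ 0`:
  `|∫_{(0,2a]} σ(t) sin(π m/a · t) dt| ≤ a/(π|m|)`, the moments entering `sechIncrCoeff a n m`
  (`TwistedGramOddReal.lean`).

No definitions; no named facts; RH/GRH-free; standard axioms.
-/

set_option autoImplicit false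

noncomputable section

open MeasureTheory Set intervalIntegral
open scoped Real

namespace Summit.Ventures.WeilGRH

/-- `σ'(t) = −sinh(t/2)/(4cosh²(t/2))` for `σ(t) = 1/(2cosh(t/2))`. -/
theorem hasDerivAt_sech_density (t : ℝ) :
    HasDerivAt (fun t : ℝ ↦ 1 / (2 * Real.cosh (t / 2))) (-Real.sinh (t / 2) / (4 * Real.cosh (t / 2) ^ 2)) t := by
  have h1 : HasDerivAt (fun t : ℝ ↦ 2 * Real.cosh (t / 2)) (2 * (Real.sinh (t / 2) * (1 / 2))) t :=
    (((hasDerivAt_id' t).div_const 2).cosh).const_mul 2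
  have hne : 2 * Real.cosh (t / 2) ≠ 0 := by positivity
  have h2 := (hasDerivAt_const t (1 : ℝ)).div h1 hne
  have hfun : (fun t : ℝ ↦ 1 / (2 * Real.cosh (t / 2))) = (fun _ : ℝ ↦ (1 : ℝ)) / fun t : ℝ ↦ 2 * Real.cosh (t / 2) := by
    funext x
    simp only [Pi.div_apply]
  rw [hfun]
  refine h2.congr_deriv ?_
  field_simp
  ring

/-- `σ'` is continuous. -/
theorem continuous_deriv_sech_density :
    Continuous fun t : ℝ ↦ -Real.sinh (t / 2) / (4 * Real.cosh (t / 2) ^ 2) :=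
  ((Real.continuous_sinh.comp (continuous_id.div_const 2)).neg).div
    (continuous_const.mul ((Real.continuous_cosh.comp (continuous_id.div_const 2)).pow 2)) fun t ↦ by positivity

/-- **`|∫₀^T σ(t) sin(ωt) dt| ≤ 1/ω`** for `ω > 0`, `T ≥ 0`. -/
theorem abs_integral_sech_mul_sin_le {ω T : ℝ} (hω : 0 < ω) (hT : 0 ≤ T) :
    |∫ t in (0 : ℝ)..T, 1 / (2 * Real.cosh (t / 2)) * Real.sin (ω * t)| ≤ 1 / ω := by
  set σ : ℝ → ℝ := fun t ↦ 1 / (2 * Real.cosh (t / 2)) with hσ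
  set σ' : ℝ → ℝ := fun t ↦ -Real.sinh (t / 2) / (4 * Real.cosh (t / 2) ^ 2) with hσ'
  set v : ℝ → ℝ := fun t ↦ -Real.cos (ω * t) / ω with hv
  have hωne : ω ≠ 0 := hω.ne'
  have hdv : ∀ t, HasDerivAt v (Real.sin (ω * t)) t := fun t ↦ by
    have h := (((hasDerivAt_id' t).const_mul ω).cos).const_mul (-1 / ω)
    have hfun : v = fun x : ℝ ↦ -1 / ω * Real.cos (ω * x) := by
      funext x; simp only [hv]; ring
    rw [hfun]
    refine h.congr_deriv ?_
    field_simp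
  have hparts := intervalIntegral.integral_mul_deriv_eq_deriv_mul (a := 0) (b := T) (u := σ) (v := v) (u' := σ')
    (v' := fun t ↦ Real.sin (ω * t)) (fun t _ ↦ hasDerivAt_sech_density t) (fun t _ ↦ hdv t)
    (continuous_deriv_sech_density.intervalIntegrable _ _)
    ((Real.continuous_sin.comp (continuous_const.mul continuous_id)).intervalIntegrable _ _)
  rw [hparts]
  -- boundary terms
  have hσ0 : σ 0 = 1 / 2 := by simp [hσ]
  have hσpos : ∀ t, 0 < σ t := fun t ↦ by simp only [hσ]; positivity
  have hσle : ∀ t, σ t ≤ 1 / 2 := fun t ↦ by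
    simp only [hσ]
    exact div_le_div_of_nonneg_left (by norm_num) (by norm_num) (by linarith [Real.one_le_cosh (t / 2)])
  have hvb : ∀ t, |v t| ≤ 1 / ω := fun t ↦ by
    simp only [hv, abs_div, abs_neg, abs_of_pos hω]
    exact div_le_div_of_nonneg_right (Real.abs_cos_le_one _) hω.le
  have hb1 : |σ T * v T| ≤ σ T / ω := by
    rw [abs_mul, abs_of_pos (hσpos T), ← mul_one_div]
    exact mul_le_mul_of_nonneg_left (hvb T) (hσpos T).le
  have hb0 : |σ 0 * v 0| ≤ σ 0 / ω := by
    rw [abs_mul, abs_of_pos (hσpos 0), ← mul_one_div]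
    exact mul_le_mul_of_nonneg_left (hvb 0) (hσpos 0).le
  -- bulk term: `|∫ σ' v| ≤ ∫ (−σ')/ω = (σ 0 − σ T)/ω`
  have hbulk : |∫ t in (0 : ℝ)..T, σ' t * v t| ≤ (σ 0 - σ T) / ω := by
    have hle : |∫ t in (0 : ℝ)..T, σ' t * v t| ≤ ∫ t in (0 : ℝ)..T, -σ' t / ω := by
      rw [← Real.norm_eq_abs]
      refine intervalIntegral.norm_integral_le_of_norm_le hT (Filter.Eventually.of_forall fun t ht ↦ ?_)
        ((continuous_deriv_sech_density.neg.div_const ω).intervalIntegrable _ _)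
      have hneg : σ' t ≤ 0 := by
        simp only [hσ']
        exact div_nonpos_of_nonpos_of_nonneg (neg_nonpos.mpr (Real.sinh_nonneg_iff.mpr (by linarith [ht.1])))
          (by positivity)
      rw [Real.norm_eq_abs, abs_mul, abs_of_nonpos hneg]
      refine (mul_le_mul_of_nonneg_left (hvb t) (neg_nonneg.mpr hneg)).trans_eq ?_
      ring
    have hint : ∫ t in (0 : ℝ)..T, -σ' t / ω = (σ 0 - σ T) / ω := by
      have h := intervalIntegral.integral_eq_sub_of_hasDerivAt (a := 0) (b := T) (f := fun t ↦ -σ t / ω)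
        (f' := fun t ↦ -σ' t / ω) (fun t _ ↦ ((hasDerivAt_sech_density t).neg).div_const ω)
        ((continuous_deriv_sech_density.neg.div_const ω).intervalIntegrable _ _)
      rw [h]
      ring
    exact hle.trans hint.le
  -- assemble: (σ T + σ 0 + σ 0 − σ T)/ω = 2σ(0)/ω = 1/ω
  have htri : |σ T * v T - σ 0 * v 0 - ∫ t in (0 : ℝ)..T, σ' t * v t|
      ≤ |σ T * v T| + |σ 0 * v 0| + |∫ t in (0 : ℝ)..T, σ' t * v t| := by
    refine (abs_sub _ _).trans ?_
    linarith [abs_sub (σ T * v T) (σ 0 * v 0)]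
  have hsum : σ T / ω + σ 0 / ω + (σ 0 - σ T) / ω = 1 / ω := by
    rw [hσ0]; field_simp; ring
  linarith

/-- **The `sech` sine moments of Yoshida's window**: `|∫_{(0,2a]} σ(t) sin(π m/a · t) dt| ≤ a/(π|m|)` for `a > 0`,
`m ≠ 0` — the moments entering `sechIncrCoeff a n m`. -/
theorem abs_setIntegral_sech_mul_sin_freq_le {a : ℝ} (ha : 0 < a) {m : ℤ} (hm : m ≠ 0) :
    |∫ t in Ioc 0 (2 * a), 1 / (2 * Real.cosh (t / 2)) * Real.sin (π * m / a * t)| ≤ a / (π * |(m : ℝ)|) := by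
  have hT : (0 : ℝ) ≤ 2 * a := by positivity
  rw [← intervalIntegral.integral_of_le hT]
  rcases lt_or_gt_of_ne hm with hneg | hpos
  · -- negative frequency: `sin(−ωt) = −sin(ωt)`
    have hω : 0 < π * ((-m : ℤ) : ℝ) / a := by
      have : (0 : ℝ) < ((-m : ℤ) : ℝ) := by exact_mod_cast (by omega : 0 < -m)
      positivity
    have h := abs_integral_sech_mul_sin_le hω hT
    have hrew : ∫ t in (0 : ℝ)..2 * a, 1 / (2 * Real.cosh (t / 2)) * Real.sin (π * m / a * t)
        = -∫ t in (0 : ℝ)..2 * a, 1 / (2 * Real.cosh (t / 2)) * Real.sin (π * ((-m : ℤ) : ℝ) / a * t) := by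
      rw [← intervalIntegral.integral_neg]
      refine intervalIntegral.integral_congr fun t _ ↦ ?_
      simp only [Int.cast_neg]
      rw [show π * -(m : ℝ) / a * t = -(π * m / a * t) by ring, Real.sin_neg]
      ring
    rw [hrew, abs_neg]
    refine h.trans (le_of_eq ?_)
    have hmabs : |(m : ℝ)| = ((-m : ℤ) : ℝ) := by
      rw [Int.cast_neg, abs_of_neg (by exact_mod_cast hneg)]
    rw [hmabs]
    field_simp
  · have hω : 0 < π * (m : ℝ) / a := by
      have : (0 : ℝ) < (m : ℝ) := by exact_mod_cast hpos
      positivity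
    refine (abs_integral_sech_mul_sin_le hω hT).trans (le_of_eq ?_)
    rw [abs_of_pos (by exact_mod_cast hpos : (0 : ℝ) < (m : ℝ))]
    field_simp

end Summit.Ventures.WeilGRH

end
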